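import Summits.HubbardSuperconductivity.HubbardLadder.EigenWindowRows
import Literature.MathematicalPhysics.QuantumManyBody.StateRelaxationKKT
import Literature.MathematicalPhysics.QuantumLattice.GroundStateReflectionPositivityHeisenberg
import HarnessLib

/-!
# Rung R2 — double-commutator (second-order local-stability) certificate blocks, kind `dcomm`

HONEST FRAMING (page 1): ladder R1–R4 with certified numbers; no claim on H/H₀.

Block kind `dcomm` of the cell's certificate format (pseudo seat, family F13, PSEUDO.md §9,
TO-ENG.md §A.F13).  For a Hamiltonian `h`, a multiplier matrix `G` and a finite generator family
`B`, the DOUBLE-COMMUTATOR element is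

  `dcommForm h G B = Σ_ab G_ab • ([B_a⋆, [h, B_b]]) = Σ_ab G_ab • (B_a⋆ (h B_b - B_b h) - (h B_b - B_b h) B_a⋆)`,

the dual image of the primal PSD constraint `[ω([B_a⋆, [h, B_b]])]_{ab} ⪰ 0` — the second-order
condition for a ground state to be stable under the unitary flow `exp(i Σ t_b B_b + h.c.)`
(the "double-commutator" / stability form of the equations-of-motion method, Rowe 1968 §III;
the killer condition of second-order reduced-density-matrix theory, Erdahl–Garrod–Mihailović–Rosina).
The operator identity (proved here, `dcommForm_eq`)

  `dcommForm h G B = kktForm h G B + kktForm h Gᵀ (B⋆) - (h X - X h)`,  `X = Σ_ab G_ab • B_b B_a⋆`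
  (`dcommPair`),

exhibits it as the SUM of the two state-optimality ("KKT") elements of
`Literature.….StateRelaxation.kktForm` — for the family `B` and for the adjoint family `B⋆`, the
latter with the transposed multiplier — plus an equation-of-motion null term.  Hence NO new
soundness predicate: for `G ⪰ 0` its expectation is `≥ 0` in
* every sector ground state `ψ ∈ K`, `A ψ = E_K ψ`, provided every `B_b` AND every `B_b⋆` maps `K`
  into `K` (`re_vectorState_dcommForm_nonneg_of_sectorGS`; Bratteli–Robinson II Prop. 5.3.19 twice);
* the tracial ground state of any Hermitian matrix, for ANY generators
  (`re_groundStateFunctional_dcommForm_nonneg`, from `re_groundStateFunctional_kktForm_nonneg`).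
The point of the block for moment relaxations (why it is not the `kkt` block in disguise at a
given relaxation level): for two-letter generators the top-degree words of the two KKT Gram forms
cancel in the sum, so `dcommForm` lives one degree LOWER than either `kktForm` (pseudo seat,
PSEUDO.md §9.1; Erdahl's `T2 → T2'` cancellation).  That is a statement about supports, not about
soundness, and is not formalised.

Certificate rows (shape of `StateRelaxation.groundEnergy_ge_of_certificate` /
`heisenbergTorus_groundEnergy_ge_of_certificate_rp`): an identity
`A − c·1 = Σ Λᵢⱼ Oᵢᴴ Oⱼ + (Σₖ (A Xₖ − Xₖ A) + Σₗ (Uₗ Yₗ Uₗᴴ − Yₗ)) + (kktForm A G B + dcommForm A G' B' + r)`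
with `Λ, G, G' ⪰ 0`, unitaries `Uₗ` commuting with `A` and `−ε ≤ Re ω₀(r)` certifies
`c − ε ≤ E₀(A)` for EVERY Hermitian `A` (`groundEnergy_ge_of_certificate_kkt_dcomm`), in particular
for the Heisenberg model on a torus of ANY side, dimension, spin and sign of `J`
(`heisenbergTorus_groundEnergy_ge_of_certificate_kkt_dcomm`) — unlike the `rp` row, no parity,
reflection or uniqueness hypothesis is involved.  No certificate exists in this file; these are
soundness edges (rows) for certificates produced and checked elsewhere.

Sources: D. J. Rowe, Rev. Mod. Phys. 40 (1968) 153, §III (double-commutator equations of motion);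
C. Garrod, M. V. Mihailović, M. Rosina, J. Math. Phys. 16 (1975) 868, §II; M. Araújo et al. (2023)
§3.2 Prop. 11 (state optimality); O. Bratteli, D. W. Robinson II, Prop. 5.3.19.  No new named facts;
everything is proved.
-/

namespace Summit.HubbardSuperconductivity.HubbardLadder

open Matrix Finset Literature.Probability.LatticeModels
  Literature.MathematicalPhysics.QuantumLattice
  Literature.MathematicalPhysics.QuantumManyBody.StateRelaxation
open scoped ComplexOrder

noncomputable section

/-! ## §1 Abstract `⋆`-algebra: the element and its decomposition -/

section Abstract

variable {𝓐 : Type*} [Ring 𝓐] [StarRing 𝓐] [Algebra ℂ 𝓐]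
variable {m : Type*} [Fintype m]

/-- The double-commutator ("second-order stability", `dcomm`) element
`Σ_ab G_ab • (B_a⋆ (h B_b - B_b h) - (h B_b - B_b h) B_a⋆) = Σ_ab G_ab • [B_a⋆, [h, B_b]]` of a
multiplier matrix `G` and a finite generator family `B`. [cite: Rowe1968, §III] -/
def dcommForm (h : 𝓐) (G : Matrix m m ℂ) (B : m → 𝓐) : 𝓐 :=
  ∑ i, ∑ j, G i j • (star (B i) * (h * B j - B j * h) - (h * B j - B j * h) * star (B i))

/-- The pairing operator `X = Σ_ab G_ab • B_b B_a⋆` whose commutator with `h` is the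
equation-of-motion part of `dcommForm`. [cite: Rowe1968, §III] -/
def dcommPair (G : Matrix m m ℂ) (B : m → 𝓐) : 𝓐 :=
  ∑ i, ∑ j, G i j • (B j * star (B i))

/-- `ω` of the double-commutator element is the entrywise pairing of `G` with the block
`[ω(B_a⋆ (h B_b - B_b h) - (h B_b - B_b h) B_a⋆)]_{ab}`. [cite: Rowe1968, §III] -/
theorem map_dcommForm (ω : 𝓐 →ₗ[ℂ] ℂ) (h : 𝓐) (G : Matrix m m ℂ) (B : m → 𝓐) :
    ω (dcommForm h G B) =
      ∑ i, ∑ j, G i j * ω (star (B i) * (h * B j - B j * h) - (h * B j - B j * h) * star (B i)) := by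
  simp [dcommForm, map_sum, smul_eq_mul]

/-- **Decomposition of the double commutator** (the operator identity
`[B⋆, [h, B']] = B⋆ [h, B'] + B' [h, B⋆] − [h, B' B⋆]`, summed against `G`):
`dcommForm h G B = kktForm h G B + kktForm h Gᵀ (B⋆) − (h X − X h)`, `X = dcommPair G B`.
[cite: Rowe1968, §III] [cite: GarrodMihailovicRosina1975, §II] [cite: AraujoEtAl2023, §3.2 Prop. 11] -/
theorem dcommForm_eq (h : 𝓐) (G : Matrix m m ℂ) (B : m → 𝓐) :
    dcommForm h G B =
      kktForm h G B + kktForm h Gᵀ (star ∘ B) - (h * dcommPair G B - dcommPair G B * h) := by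
  have h2 : kktForm h Gᵀ (star ∘ B) =
      ∑ i, ∑ j, G i j • (B j * (h * star (B i) - star (B i) * h)) := by
    unfold kktForm
    conv_lhs => rw [Finset.sum_comm]
    simp only [Matrix.transpose_apply, Function.comp_apply, star_star]
  have h3 : h * dcommPair G B - dcommPair G B * h =
      ∑ i, ∑ j, G i j • (h * (B j * star (B i)) - B j * star (B i) * h) := by
    unfold dcommPair
    simp only [Finset.mul_sum, Finset.sum_mul, mul_smul_comm, smul_mul_assoc, smul_sub,
      Finset.sum_sub_distrib]
  rw [h2, h3]
  unfold dcommForm kktForm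
  rw [← Finset.sum_add_distrib, ← Finset.sum_sub_distrib]
  refine Finset.sum_congr rfl fun i _ => ?_
  rw [← Finset.sum_add_distrib, ← Finset.sum_sub_distrib]
  refine Finset.sum_congr rfl fun j _ => ?_
  rw [← smul_add, ← smul_sub]
  congr 1
  noncomm_ring

/-- **Weak duality for the `dcomm` block in a state annihilating commutators with `h`:** if
`ω(h X − X h) = 0` for the pairing operator and both KKT elements have nonnegative real expectation,
so has `dcommForm`. [cite: AraujoEtAl2023, §3.2 Prop. 11] -/
theorem re_map_dcommForm_nonneg_of_kkt (ω : 𝓐 →ₗ[ℂ] ℂ) (h : 𝓐) (G : Matrix m m ℂ) (B : m → 𝓐)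
    (hstat : ω (h * dcommPair G B - dcommPair G B * h) = 0)
    (h1 : 0 ≤ (ω (kktForm h G B)).re) (h2 : 0 ≤ (ω (kktForm h Gᵀ (star ∘ B))).re) :
    0 ≤ (ω (dcommForm h G B)).re := by
  rw [dcommForm_eq, map_sub, map_add, hstat, sub_zero, Complex.add_re]
  exact add_nonneg h1 h2

end Abstract

/-! ## §2 Matrix instances: sector ground states and the tracial ground state -/

section MatrixInstances

variable {n : Type*} [Fintype n] [DecidableEq n]
variable {m : Type*} [Fintype m] [DecidableEq m]

/-- **`dcomm` block ⇒ nonnegative expectation in every sector ground state.** For Hermitian `A`,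
a sector `K`, `G ⪰ 0`, generators `B_b` such that every `B_b` AND every `B_bᴴ` maps `K` into `K`,
and a sector ground state `ψ ∈ K`, `A ψ = E_K ψ`: `0 ≤ Re ⟨ψ, dcommForm A G B ψ⟩`
(`= Re ⟨ψ, kktForm A G B ψ⟩ + Re ⟨ψ, kktForm A Gᵀ Bᴴ ψ⟩`, the commutator term having zero
expectation in an eigenvector). For `S^z`-charged spin words take `K = ⊤` (a GLOBAL ground state).
[cite: BratteliRobinsonII1997, Prop. 5.3.19] [cite: Rowe1968, §III] -/
theorem re_vectorState_dcommForm_nonneg_of_sectorGS {A : Matrix n n ℂ} (hA : A.IsHermitian)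
    (K : Submodule ℂ (n → ℂ)) {G : Matrix m m ℂ} (hG : G.PosSemidef) (B : m → Matrix n n ℂ)
    (hB : ∀ j, ∀ w ∈ K, B j *ᵥ w ∈ K) (hBs : ∀ j, ∀ w ∈ K, (B j)ᴴ *ᵥ w ∈ K)
    {ψ : n → ℂ} (hψK : ψ ∈ K) (hAψ : A *ᵥ ψ = ((A.minEnergyOn K : ℝ) : ℂ) • ψ) :
    0 ≤ (star ψ ⬝ᵥ dcommForm A G B *ᵥ ψ).re := by
  have h1 := re_vectorState_kktForm_nonneg_of_sectorGS hA K hG B hB hψK hAψ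
  have h2 := re_vectorState_kktForm_nonneg_of_sectorGS hA K hG.transpose (star ∘ B)
    (fun j w hw => by
      simpa only [Function.comp_apply, Matrix.star_eq_conjTranspose] using hBs j w hw) hψK hAψ
  have hstat : Literature.MathematicalPhysics.QuantumManyBody.StateRelaxation.vectorState ψ
      (A * dcommPair G B - dcommPair G B * A) = 0 := by
    rw [map_sub, vectorState_mul_left_of_eigenvector hA hAψ,
      vectorState_mul_right_of_eigenvector hAψ, sub_self]
  have h := re_map_dcommForm_nonneg_of_kkt
    (Literature.MathematicalPhysics.QuantumManyBody.StateRelaxation.vectorState ψ) A G B hstat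
    (by rwa [Literature.MathematicalPhysics.QuantumManyBody.StateRelaxation.vectorState_apply])
    (by rwa [Literature.MathematicalPhysics.QuantumManyBody.StateRelaxation.vectorState_apply])
  rwa [Literature.MathematicalPhysics.QuantumManyBody.StateRelaxation.vectorState_apply] at h

/-- The ground-state inequality for the TRACIAL ground state `ω₀ = tr(P₀ ·)/tr P₀` of a Hermitian
matrix, one generator: `0 ≤ Re ω₀(Cᴴ (A C − C A)) = Re ω₀(Cᴴ (A − E₀) C)`.
[cite: BratteliRobinsonII1997, Prop. 5.3.19] -/
theorem re_groundStateFunctional_conjTranspose_mul_commutator_nonneg {A : Matrix n n ℂ}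
    (hA : A.IsHermitian) (C : Matrix n n ℂ) :
    0 ≤ (A.groundStateFunctional (Cᴴ * (A * C - C * A))).re := by
  have hps : (Cᴴ * (A - algebraMap ℝ (Matrix n n ℂ) A.groundEnergy) * C).PosSemidef :=
    (posSemidef_sub_groundEnergy hA).conjTranspose_mul_mul_same C
  have h0 := groundStateFunctional_nonneg_of_posSemidef A hps
  have heq : A.groundStateFunctional (Cᴴ * (A * C - C * A)) =
      A.groundStateFunctional (Cᴴ * (A - algebraMap ℝ (Matrix n n ℂ) A.groundEnergy) * C) := by
    rw [Matrix.mul_sub, ← Matrix.mul_assoc, ← Matrix.mul_assoc, map_sub,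
      groundStateFunctional_mul_hamiltonian, Algebra.algebraMap_eq_smul_one, Matrix.mul_sub,
      Matrix.sub_mul, Matrix.mul_smul, Matrix.mul_one, Matrix.smul_mul, map_sub,
      LinearMap.map_smul_of_tower, Complex.real_smul]
  rw [heq]
  exact (Complex.nonneg_iff.mp h0).1

/-- **`kkt` block in the tracial ground state, ANY generators**: `0 ≤ Re ω₀(kktForm A G B)` for
Hermitian `A` and `G ⪰ 0`. [cite: AraujoEtAl2023, §3.2 Prop. 11] [cite: BratteliRobinsonII1997, Prop. 5.3.19] -/
theorem re_groundStateFunctional_kktForm_nonneg {A : Matrix n n ℂ} (hA : A.IsHermitian)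
    {G : Matrix m m ℂ} (hG : G.PosSemidef) (B : m → Matrix n n ℂ) :
    0 ≤ (A.groundStateFunctional (kktForm A G B)).re :=
  re_map_kktForm_nonneg _ A hG B fun w => by
    rw [Matrix.star_eq_conjTranspose]
    exact re_groundStateFunctional_conjTranspose_mul_commutator_nonneg hA _

/-- **`dcomm` block in the tracial ground state, ANY generators**: `0 ≤ Re ω₀(dcommForm A G B)`
for Hermitian `A` and `G ⪰ 0` (both KKT parts nonnegative, the commutator part has zero
expectation). [cite: Rowe1968, §III] [cite: BratteliRobinsonII1997, Prop. 5.3.19] -/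
theorem re_groundStateFunctional_dcommForm_nonneg {A : Matrix n n ℂ} (hA : A.IsHermitian)
    {G : Matrix m m ℂ} (hG : G.PosSemidef) (B : m → Matrix n n ℂ) :
    0 ≤ (A.groundStateFunctional (dcommForm A G B)).re :=
  re_map_dcommForm_nonneg_of_kkt _ A G B
    (by rw [map_sub, groundStateFunctional_hamiltonian_mul hA,
      groundStateFunctional_mul_hamiltonian, sub_self])
    (re_groundStateFunctional_kktForm_nonneg hA hG B)
    (re_groundStateFunctional_kktForm_nonneg hA hG.transpose _)

/-! ## §3 Certificate rows -/

variable {p : Type*} [Fintype p] [DecidableEq p]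
variable {q : Type*} [Fintype q] [DecidableEq q]

/-- **Energy row with a `kkt` block, a `dcomm` block and a residual** (the form a rounded
ground-state bootstrap certificate takes): for ANY Hermitian `A`, an identity
`A − c·1 = Σ Λᵢⱼ Oᵢᴴ Oⱼ + (Σₖ (A Xₖ − Xₖ A) + Σₗ (Uₗ Yₗ Uₗᴴ − Yₗ)) + (kktForm A G B + dcommForm A G' B' + r)`
with `Λ, G, G' ⪰ 0`, unitaries `Uₗ` commuting with `A`, arbitrary generators `B`, `B'`, and a
residual with `−ε ≤ Re ω₀(r)` certifies `c − ε ≤ E₀(A)`.  Several blocks of one kind are one block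
with a block-diagonal multiplier (`kktForm_add`). [cite: AraujoEtAl2023, §3.2 Prop. 11]
[cite: KullEtAl2024, §5.3] [cite: Rowe1968, §III] -/
theorem groundEnergy_ge_of_certificate_kkt_dcomm [Nonempty n] {A : Matrix n n ℂ} (hA : A.IsHermitian)
    {m' : Type*} [Fintype m'] [DecidableEq m'] {Λ : Matrix m' m' ℂ} (hΛ : Λ.PosSemidef)
    (O : m' → Matrix n n ℂ)
    {ι₁ : Type*} (s : Finset ι₁) (X : ι₁ → Matrix n n ℂ)
    {ι₂ : Type*} (t : Finset ι₂) (U Y : ι₂ → Matrix n n ℂ)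
    (hU : ∀ l ∈ t, U l * A = A * U l) (hUU : ∀ l ∈ t, (U l)ᴴ * U l = 1)
    {G : Matrix p p ℂ} (hG : G.PosSemidef) (B : p → Matrix n n ℂ)
    {G' : Matrix q q ℂ} (hG' : G'.PosSemidef) (B' : q → Matrix n n ℂ)
    {r : Matrix n n ℂ} {ε : ℝ} (hr : -ε ≤ (A.groundStateFunctional r).re) {c : ℝ}
    (hcert : A - (c : ℂ) • (1 : Matrix n n ℂ) =
      gramForm Λ O +
        (∑ b ∈ s, (A * X b - X b * A) + ∑ l ∈ t, (U l * Y l * (U l)ᴴ - Y l)) +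
        (kktForm A G B + dcommForm A G' B' + r)) :
    c - ε ≤ A.groundEnergy := by
  set ω := A.groundStateFunctional with hω
  have hpos : ∀ x : Matrix n n ℂ, 0 ≤ ω (star x * x) := fun x => by
    rw [hω, Matrix.star_eq_conjTranspose]; exact groundStateFunctional_nonneg A x
  have hone : ω 1 = 1 := groundStateFunctional_one hA
  have hnull : ω (∑ b ∈ s, (A * X b - X b * A) + ∑ l ∈ t, (U l * Y l * (U l)ᴴ - Y l)) = 0 := by
    rw [map_add, map_sum, map_sum]
    have h1 : ∀ b ∈ s, ω (A * X b - X b * A) = 0 := fun b _ => by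
      rw [map_sub, hω, groundStateFunctional_hamiltonian_mul hA,
        groundStateFunctional_mul_hamiltonian, sub_self]
    have h2 : ∀ l ∈ t, ω (U l * Y l * (U l)ᴴ - Y l) = 0 := fun l hl => by
      rw [map_sub, hω, groundStateFunctional_conj_of_commute hA (hU l hl) (hUU l hl), sub_self]
    rw [Finset.sum_eq_zero h1, Finset.sum_eq_zero h2, add_zero]
  have hk : 0 ≤ (ω (kktForm A G B)).re := re_groundStateFunctional_kktForm_nonneg hA hG B
  have hd : 0 ≤ (ω (dcommForm A G' B')).re := re_groundStateFunctional_dcommForm_nonneg hA hG' B'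
  have hr' : -ε ≤ (ω (kktForm A G B + dcommForm A G' B' + r)).re := by
    rw [map_add, map_add, Complex.add_re, Complex.add_re]
    have hr0 : -ε ≤ (ω r).re := hr
    linarith
  have h := le_re_map_of_certificate_residual ω hpos hone hΛ O hnull hr' hcert
  rw [hω, groundStateFunctional_hamiltonian hA, Complex.ofReal_re] at h
  exact h

/-- **Exact form** (`r = 0`, `ε = 0`): `c ≤ E₀(A)`. [cite: AraujoEtAl2023, §3.2 Prop. 11] [cite: Rowe1968, §III] -/
theorem groundEnergy_ge_of_certificate_kkt_dcomm_exact [Nonempty n] {A : Matrix n n ℂ}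
    (hA : A.IsHermitian)
    {m' : Type*} [Fintype m'] [DecidableEq m'] {Λ : Matrix m' m' ℂ} (hΛ : Λ.PosSemidef)
    (O : m' → Matrix n n ℂ)
    {ι₁ : Type*} (s : Finset ι₁) (X : ι₁ → Matrix n n ℂ)
    {ι₂ : Type*} (t : Finset ι₂) (U Y : ι₂ → Matrix n n ℂ)
    (hU : ∀ l ∈ t, U l * A = A * U l) (hUU : ∀ l ∈ t, (U l)ᴴ * U l = 1)
    {G : Matrix p p ℂ} (hG : G.PosSemidef) (B : p → Matrix n n ℂ)
    {G' : Matrix q q ℂ} (hG' : G'.PosSemidef) (B' : q → Matrix n n ℂ) {c : ℝ}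
    (hcert : A - (c : ℂ) • (1 : Matrix n n ℂ) =
      gramForm Λ O +
        (∑ b ∈ s, (A * X b - X b * A) + ∑ l ∈ t, (U l * Y l * (U l)ᴴ - Y l)) +
        (kktForm A G B + dcommForm A G' B')) :
    c ≤ A.groundEnergy := by
  have hcert' : A - (c : ℂ) • (1 : Matrix n n ℂ) =
      gramForm Λ O +
        (∑ b ∈ s, (A * X b - X b * A) + ∑ l ∈ t, (U l * Y l * (U l)ᴴ - Y l)) +
        (kktForm A G B + dcommForm A G' B' + 0) := by rw [hcert, add_zero]
  have h := groundEnergy_ge_of_certificate_kkt_dcomm hA hΛ O s X t U Y hU hUU hG B hG' B'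
    (r := 0) (ε := 0) (by rw [map_zero, Complex.zero_re, neg_zero]) hcert'
  linarith

end MatrixInstances

/-! ## §4 The Heisenberg torus (any side, dimension, spin, sign of `J`) -/

section Heisenberg

variable {d : ℕ}
variable {p : Type*} [Fintype p] [DecidableEq p]
variable {q : Type*} [Fintype q] [DecidableEq q]

/-- **Heisenberg-torus energy row with `kkt` and `dcomm` blocks**: an identity
`H − c·1 = Σ Λᵢⱼ Oᵢᴴ Oⱼ + (Σₖ (H Xₖ − Xₖ H) + Σₗ (Uₗ Yₗ Uₗᴴ − Yₗ)) + (kktForm H G B + dcommForm H G' B' + r)`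
for `H = heisenbergTorus d L n J` with `Λ, G, G' ⪰ 0`, unitaries `Uₗ` commuting with `H`
(translations, point group, spin rotations) and `−ε ≤ Re ω₀(r)` certifies `c − ε ≤ E₀(H)`.
No parity of `L`, no sign of `J`, no uniqueness of the ground state is needed (contrast the `rp`
row `heisenbergTorus_groundEnergy_ge_of_certificate_rp`). [cite: AraujoEtAl2023, §3.2 Prop. 11]
[cite: Rowe1968, §III] [cite: KullEtAl2024, §5.3] -/
theorem heisenbergTorus_groundEnergy_ge_of_certificate_kkt_dcomm (L : ℕ) [NeZero L] (n : ℕ) (J : ℝ)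
    {m' : Type*} [Fintype m'] [DecidableEq m'] {Λ : Matrix m' m' ℂ} (hΛ : Λ.PosSemidef)
    (O : m' → Op (TorusSite d L) (n + 1))
    {ι₁ : Type*} (s : Finset ι₁) (X : ι₁ → Op (TorusSite d L) (n + 1))
    {ι₂ : Type*} (t : Finset ι₂) (U Y : ι₂ → Op (TorusSite d L) (n + 1))
    (hU : ∀ l ∈ t, U l * heisenbergTorus d L n J = heisenbergTorus d L n J * U l)
    (hUU : ∀ l ∈ t, (U l)ᴴ * U l = 1)
    {G : Matrix p p ℂ} (hG : G.PosSemidef) (B : p → Op (TorusSite d L) (n + 1))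
    {G' : Matrix q q ℂ} (hG' : G'.PosSemidef) (B' : q → Op (TorusSite d L) (n + 1))
    {r : Op (TorusSite d L) (n + 1)} {ε : ℝ}
    (hr : -ε ≤ ((heisenbergTorus d L n J).groundStateFunctional r).re) {c : ℝ}
    (hcert : heisenbergTorus d L n J - (c : ℂ) • (1 : Op (TorusSite d L) (n + 1)) =
      gramForm Λ O +
        (∑ b ∈ s, (heisenbergTorus d L n J * X b - X b * heisenbergTorus d L n J) +
          ∑ l ∈ t, (U l * Y l * (U l)ᴴ - Y l)) +
        (kktForm (heisenbergTorus d L n J) G B + dcommForm (heisenbergTorus d L n J) G' B' + r)) :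
    c - ε ≤ (heisenbergTorus d L n J).groundEnergy :=
  groundEnergy_ge_of_certificate_kkt_dcomm (heisenbergHamiltonian_isHermitian n _ J) hΛ O s X t U Y
    hU hUU hG B hG' B' hr hcert

/-- **Exact Heisenberg-torus row** (`r = 0`): `c ≤ E₀(H)`. [cite: AraujoEtAl2023, §3.2 Prop. 11] [cite: Rowe1968, §III] -/
theorem heisenbergTorus_groundEnergy_ge_of_certificate_kkt_dcomm_exact (L : ℕ) [NeZero L] (n : ℕ)
    (J : ℝ) {m' : Type*} [Fintype m'] [DecidableEq m'] {Λ : Matrix m' m' ℂ} (hΛ : Λ.PosSemidef)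
    (O : m' → Op (TorusSite d L) (n + 1))
    {ι₁ : Type*} (s : Finset ι₁) (X : ι₁ → Op (TorusSite d L) (n + 1))
    {ι₂ : Type*} (t : Finset ι₂) (U Y : ι₂ → Op (TorusSite d L) (n + 1))
    (hU : ∀ l ∈ t, U l * heisenbergTorus d L n J = heisenbergTorus d L n J * U l)
    (hUU : ∀ l ∈ t, (U l)ᴴ * U l = 1)
    {G : Matrix p p ℂ} (hG : G.PosSemidef) (B : p → Op (TorusSite d L) (n + 1))
    {G' : Matrix q q ℂ} (hG' : G'.PosSemidef) (B' : q → Op (TorusSite d L) (n + 1)) {c : ℝ}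
    (hcert : heisenbergTorus d L n J - (c : ℂ) • (1 : Op (TorusSite d L) (n + 1)) =
      gramForm Λ O +
        (∑ b ∈ s, (heisenbergTorus d L n J * X b - X b * heisenbergTorus d L n J) +
          ∑ l ∈ t, (U l * Y l * (U l)ᴴ - Y l)) +
        (kktForm (heisenbergTorus d L n J) G B + dcommForm (heisenbergTorus d L n J) G' B')) :
    c ≤ (heisenbergTorus d L n J).groundEnergy :=
  groundEnergy_ge_of_certificate_kkt_dcomm_exact (heisenbergHamiltonian_isHermitian n _ J) hΛ O s X t
    U Y hU hUU hG B hG' B' hcert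

end Heisenberg

end

end Summit.HubbardSuperconductivity.HubbardLadder
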